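import Literature.MathematicalPhysics.QuantumLattice.HubbardFermionInteractionTerms
import Literature.MathematicalPhysics.QuantumLattice.HubbardNNNHopping
import HarnessLib

/-!
# The `t–t'` (next-nearest-neighbour) Hubbard interaction on `ℤ²` as a finite-range
# `FermionInteraction`

Topic `Literature/MathematicalPhysics/QuantumLattice`. The companion of
`HubbardFermionInteractionTerms.lean` (nearest-neighbour Hubbard interaction
`hubbardFermionInteraction d t U`) for the DIAGONAL hopping of the `t–t'` Hubbard model of the
square lattice (Xu et al., Science 384 (2024) eadh7691, eq. (1); the tree's torus Hamiltonian
`hubbardTorusTT' L t t' U = hamiltonian (n.n.) t U + hamiltonian (diagonal) t' 0`,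
`HubbardNNNHopping.lean`):

* `diagVec s` — the two diagonal jump vectors `e₁ + e₂` (`s = 0`) and `e₁ − e₂` (`s = 1`) of
  `ℤ²` (the lattice lifts of `torusDiagJump L s`);
* `diagHoppingFermionInteraction t'` — the even, Hermitian, range-`1` interaction
  `Φ {x, x + e₁ ± e₂} = −t' Σ_σ (c†_{xσ} c_{x+e₁±e₂,σ} + h.c.)`, `Φ X = 0` otherwise, with its three
  cases (`_apply_pair`, `_apply_eq_zero`) and its mean-energy observable
  `E_Φ = Σ_s (½ Γ(Φ{0, j_s}) + ½ Γ(Φ{−j_s, 0}))` (`diagHoppingFermionInteraction_meanEnergyObs`);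
* `hubbardTTPrimeFermionInteraction t t' U` — the `t–t'` Hubbard interaction, the pointwise sum of
  the nearest-neighbour Hubbard interaction and the diagonal hopping; its local Hamiltonians and
  mean-energy observable are the sums of those of the two parts
  (`FermionInteraction.localHamiltonian_of_add`, `FermionInteraction.meanEnergyObs_of_add`).

This is the first link of the reduce-mode (window) certificate chain for the `t–t'` model
(translates of `E_Φ` sum to `hubbardTorusTT'`: `HubbardNNNHoppingInteractionTorus.lean`).
Everything is PROVED; the definitions are the interaction terms themselves.

## References
* H. Xu, C.-M. Chung, M. Qin, U. Schollwöck, S. R. White, S. Zhang, *Coexistence of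
  superconductivity with partially filled stripes in the Hubbard model*, Science 384 (2024)
  eadh7691, eq. (1) (the `t–t'` Hubbard Hamiltonian). [cite: XuEtAl2024, eq. (1)]
* H. Araki, H. Moriya, *Equilibrium statistical mechanics of fermion lattice systems*,
  Rev. Math. Phys. 15 (2003) 93, §5.1 (even finite-range potentials `Φ(I) ∈ 𝔄(I)`).
  [cite: ArakiMoriya2003, §5.1]
* O. Bratteli, A. Kishimoto, D. W. Robinson, *Ground states of quantum spin systems*,
  Commun. Math. Phys. 64 (1978) 41, §3 (mean energy functional).
  [cite: BratteliKishimotoRobinson1978, §3]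
-/

noncomputable section

namespace Literature.MathematicalPhysics.QuantumLattice

open Matrix Finset HubbardWave0 Literature.Probability.LatticeModels

/-! ### The diagonal jump vectors of `ℤ²` -/

/-- The two diagonal jump vectors of the square lattice: `diagVec 0 = e₁ + e₂`,
`diagVec 1 = e₁ − e₂` (the `ℤ²` lifts of `torusDiagJump L s`). [cite: XuEtAl2024, eq. (1)] -/
def diagVec (s : Fin 2) : Site 2 := fun i => if i = 0 then 1 else if s = 0 then 1 else -1

/-- The first coordinate of a diagonal jump is `1`. [cite: XuEtAl2024, eq. (1)] -/
@[simp] theorem diagVec_apply_zero (s : Fin 2) : diagVec s 0 = 1 := by simp [diagVec]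

/-- The second coordinate of a diagonal jump is `±1`. [cite: XuEtAl2024, eq. (1)] -/
theorem diagVec_apply_one (s : Fin 2) : diagVec s 1 = if s = 0 then 1 else -1 := by
  simp [diagVec]

/-- `|(diagVec s) i| = 1`. [cite: XuEtAl2024, eq. (1)] -/
theorem abs_diagVec_apply (s : Fin 2) (i : Fin 2) : |diagVec s i| = 1 := by
  unfold diagVec
  split_ifs <;> simp

/-- A diagonal jump is nonzero. [cite: XuEtAl2024, eq. (1)] -/
theorem diagVec_ne_zero (s : Fin 2) : diagVec s ≠ 0 := fun h => by
  have := congrFun h 0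
  rw [diagVec_apply_zero] at this
  exact one_ne_zero this

/-- The sum of two diagonal jumps is nonzero (its first coordinate is `2`). [cite: XuEtAl2024, eq. (1)] -/
theorem diagVec_add_diagVec_ne_zero (s s' : Fin 2) : diagVec s + diagVec s' ≠ 0 := fun h => by
  have := congrFun h 0
  rw [Pi.add_apply, diagVec_apply_zero, diagVec_apply_zero] at this
  norm_num at this

/-- `s ↦ diagVec s` is injective. [cite: XuEtAl2024, eq. (1)] -/
theorem diagVec_injective : Function.Injective diagVec := by
  intro s s' h
  have h1 := congrFun h 1
  rw [diagVec_apply_one, diagVec_apply_one] at h1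
  have hs : s = 0 ∨ s = 1 := by fin_cases s <;> simp
  have hs' : s' = 0 ∨ s' = 1 := by fin_cases s' <;> simp
  rcases hs with rfl | rfl <;> rcases hs' with rfl | rfl <;> simp_all

/-- `x ≠ x + j_s`. [cite: XuEtAl2024, eq. (1)] -/
theorem self_ne_add_diagVec (x : Site 2) (s : Fin 2) : x ≠ x + diagVec s := fun h =>
  diagVec_ne_zero s (left_eq_add.1 h)

/-- `x + j_s + j_{s'} ≠ x`. [cite: XuEtAl2024, eq. (1)] -/
theorem add_diagVec_add_diagVec_ne_self (x : Site 2) (s s' : Fin 2) : x + diagVec s + diagVec s' ≠ x := by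
  intro h
  rw [add_assoc, add_eq_left] at h
  exact diagVec_add_diagVec_ne_zero s s' h

/-- `j_s ∈ [-1,1]² = thicken {0} 1` (the unit cube of the sup metric on `ℤ²`). [cite: FriedliVelenik2017, §3.1] -/
theorem diagVec_mem_thicken_one (s : Fin 2) : diagVec s ∈ thicken ({0} : Finset (Site 2)) 1 := by
  rw [thicken, Finset.singleton_biUnion, Nat.floor_one]
  refine mem_image.2 ⟨diagVec s, ?_, zero_add _⟩
  rw [mem_box]
  intro i
  have h := abs_diagVec_apply s i
  rw [abs_eq (by norm_num : (0 : ℤ) ≤ 1)] at h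
  rcases h with h | h <;> rw [h] <;> norm_num

/-- `-j_s ∈ [-1,1]² = thicken {0} 1` (the unit cube of the sup metric on `ℤ²`). [cite: FriedliVelenik2017, §3.1] -/
theorem neg_diagVec_mem_thicken_one (s : Fin 2) : -diagVec s ∈ thicken ({0} : Finset (Site 2)) 1 := by
  rw [thicken, Finset.singleton_biUnion, Nat.floor_one]
  refine mem_image.2 ⟨-diagVec s, ?_, zero_add _⟩
  rw [mem_box]
  intro i
  have h := abs_diagVec_apply s i
  rw [abs_eq (by norm_num : (0 : ℤ) ≤ 1)] at h
  rcases h with h | h <;> rw [Pi.neg_apply, h] <;> norm_num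

/-- `{0, j_s} ⊆ thicken {0} 1`. [cite: FriedliVelenik2017, §3.1] -/
theorem pair_diagVec_subset_thicken_one (s : Fin 2) :
    ({0, 0 + diagVec s} : Finset (Site 2)) ⊆ thicken ({0} : Finset (Site 2)) 1 := by
  rw [zero_add]
  exact insert_subset (zero_mem_thicken_zero 1) (singleton_subset_iff.2 (diagVec_mem_thicken_one s))

/-- `{-j_s, 0} ⊆ thicken {0} 1`. [cite: FriedliVelenik2017, §3.1] -/
theorem pair_neg_diagVec_subset_thicken_one (s : Fin 2) :
    ({-diagVec s, -diagVec s + diagVec s} : Finset (Site 2)) ⊆ thicken ({0} : Finset (Site 2)) 1 := by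
  rw [neg_add_cancel]
  exact insert_subset (neg_diagVec_mem_thicken_one s) (singleton_subset_iff.2 (zero_mem_thicken_zero 1))

/-! ### The diagonal hopping interaction -/

/-- **The diagonal (next-nearest-neighbour) hopping interaction of the square lattice** with
amplitude `t'`: `Φ {x, x + e₁ ± e₂} = -t' Σ_σ (c†_{xσ} c_{x+e₁±e₂,σ} + c†_{x+e₁±e₂,σ} c_{xσ})`,
`Φ X = 0` for every other `X` — an even, Hermitian, range-`1` (sup metric), translation-covariant
`FermionInteraction 2`; the `t'`-part of the `t–t'` Hubbard model of Xu et al. (2024) eq. (1),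
in the fermionic-potential format of Araki–Moriya §5.1. [cite: XuEtAl2024, eq. (1)] -/
def diagHoppingFermionInteraction (t' : ℝ) : FermionInteraction 2 where
  Φ X :=
    ∑ x ∈ X.attach, ∑ y ∈ X.attach,
      if (∃ s : Fin 2, y.1 = x.1 + diagVec s) ∧ X = {x.1, y.1} then
        -(t' : ℂ) • ∑ σ : Fin 2, ((cAt x.1 x.2 σ)ᴴ * cAt y.1 y.2 σ + (cAt y.1 y.2 σ)ᴴ * cAt x.1 x.2 σ)
      else 0

/-- **The diagonal hopping interaction is even.** [cite: ArakiMoriya2003, §1 assumption (II)] -/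
theorem diagHoppingFermionInteraction_isEven (t' : ℝ) : (diagHoppingFermionInteraction t').IsEven := by
  intro X
  have hc : ∀ (x y : Site 2) (hx : x ∈ X) (hy : y ∈ X) (σ : Fin 2),
      parityAut ((cAt x hx σ)ᴴ * cAt y hy σ) = (cAt x hx σ)ᴴ * cAt y hy σ := by
    intro x y hx hy σ
    rw [cAt, cAt, annihilation_conjTranspose, map_mul, parityAut_creation, parityAut_annihilation,
      neg_mul_neg]
  simp only [diagHoppingFermionInteraction, map_sum, apply_ite parityAut, map_zero, map_smul, map_add, hc]

/-- **The diagonal hopping interaction is Hermitian** (real `t'`). [cite: XuEtAl2024, eq. (1)] -/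
theorem diagHoppingFermionInteraction_isHermitian (t' : ℝ) :
    (diagHoppingFermionInteraction t').IsHermitian := by
  intro X
  have hc : ∀ (x y : Site 2) (hx : x ∈ X) (hy : y ∈ X) (σ : Fin 2),
      ((cAt x hx σ)ᴴ * cAt y hy σ + (cAt y hy σ)ᴴ * cAt x hx σ)ᴴ =
        (cAt x hx σ)ᴴ * cAt y hy σ + (cAt y hy σ)ᴴ * cAt x hx σ := by
    intro x y hx hy σ
    rw [Matrix.conjTranspose_add, Matrix.conjTranspose_mul, Matrix.conjTranspose_mul,
      Matrix.conjTranspose_conjTranspose, Matrix.conjTranspose_conjTranspose, add_comm]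
  unfold Matrix.IsHermitian diagHoppingFermionInteraction
  simp only [Matrix.conjTranspose_sum, apply_ite Matrix.conjTranspose, Matrix.conjTranspose_zero,
    Matrix.conjTranspose_smul, hc, Complex.star_def, map_neg, Complex.conj_ofReal]

section Terms

variable (t' : ℝ)

/-- **Diagonal bond term**: `Φ {x, x + j_s} = -t' Σ_σ (c†_{xσ} c_{x+j_s,σ} + c†_{x+j_s,σ} c_{xσ})`.
[cite: XuEtAl2024, eq. (1)] -/
theorem diagHoppingFermionInteraction_apply_pair (x : Site 2) (s : Fin 2) :
    (diagHoppingFermionInteraction t').Φ {x, x + diagVec s} =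
      -(t' : ℂ) • ∑ σ : Fin 2,
        ((cAt x (mem_insert_self _ _) σ)ᴴ *
            cAt (x + diagVec s) (mem_insert_of_mem (mem_singleton_self _)) σ +
          (cAt (x + diagVec s) (mem_insert_of_mem (mem_singleton_self _)) σ)ᴴ *
            cAt x (mem_insert_self _ _) σ) := by
  have hmem : ∀ {a : Site 2}, a ∈ ({x, x + diagVec s} : Finset (Site 2)) ↔ a = x ∨ a = x + diagVec s :=
    fun {a} => by rw [mem_insert, mem_singleton]
  simp only [diagHoppingFermionInteraction]
  rw [Finset.sum_eq_single ⟨x, mem_insert_self _ _⟩]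
  · rw [Finset.sum_eq_single ⟨x + diagVec s, mem_insert_of_mem (mem_singleton_self _)⟩, if_pos ⟨⟨s, rfl⟩, rfl⟩]
    · rintro ⟨b, hb⟩ - hne
      refine if_neg ?_
      rintro ⟨⟨s', hs'⟩, -⟩
      rcases hmem.1 hb with rfl | rfl
      · exact self_ne_add_diagVec _ s' hs'
      · exact hne rfl
    · intro h
      exact absurd (mem_attach _ _) h
  · rintro ⟨a, ha⟩ - hne
    refine Finset.sum_eq_zero fun b _ => if_neg ?_
    rintro ⟨⟨s', hs'⟩, -⟩
    rcases hmem.1 ha with rfl | rfl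
    · exact hne rfl
    · rcases hmem.1 b.2 with hb | hb
      · exact add_diagVec_add_diagVec_ne_self _ s s' (hs'.symm.trans hb)
      · exact self_ne_add_diagVec _ s' (hb.symm.trans hs')
  · intro h
    exact absurd (mem_attach _ _) h

/-- **All other terms vanish**: if `X` is not a diagonal pair `{x, x + j_s}`, then `Φ X = 0`.
[cite: XuEtAl2024, eq. (1)] -/
theorem diagHoppingFermionInteraction_apply_eq_zero {X : Finset (Site 2)}
    (h2 : ∀ (x : Site 2) (s : Fin 2), X ≠ {x, x + diagVec s}) :
    (diagHoppingFermionInteraction t').Φ X = 0 := by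
  have hB : ∀ a b : Site 2, ¬ ((∃ s : Fin 2, b = a + diagVec s) ∧ X = {a, b}) := by
    rintro a b ⟨⟨s, rfl⟩, h⟩
    exact h2 a s h
  simp only [diagHoppingFermionInteraction, hB, if_false, sum_const_zero]

/-- A singleton is not a diagonal pair. [folklore] -/
private theorem singleton_ne_pair_diagVec (y x : Site 2) (s : Fin 2) : ({y} : Finset (Site 2)) ≠ {x, x + diagVec s} := by
  intro h
  have := congrArg Finset.card h
  rw [card_singleton, card_pair (self_ne_add_diagVec x s)] at this
  exact absurd this (by norm_num)

/-- A nearest-neighbour pair is not a diagonal pair. [folklore] -/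
private theorem pair_unitVec_ne_pair_diagVec (y : Site 2) (i : Fin 2) (x : Site 2) (s : Fin 2) :
    ({y, y + unitVec i} : Finset (Site 2)) ≠ {x, x + diagVec s} := by
  intro h
  -- both pairs would have the same difference set `{± e_i} = {± j_s}`, impossible coordinatewise
  have hy : y ∈ ({x, x + diagVec s} : Finset (Site 2)) := h ▸ mem_insert_self _ _
  have hyi : y + unitVec i ∈ ({x, x + diagVec s} : Finset (Site 2)) :=
    h ▸ mem_insert_of_mem (mem_singleton_self _)
  rw [mem_insert, mem_singleton] at hy hyi
  have key : (unitVec i : Site 2) = diagVec s ∨ (unitVec i : Site 2) = -diagVec s := by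
    rcases hy with rfl | rfl
    · rcases hyi with h' | h'
      · exact absurd h' (self_ne_add_unitVec _ i).symm
      · exact Or.inl (add_left_cancel h')
    · rcases hyi with h' | h'
      · refine Or.inr ?_
        have : x + diagVec s + unitVec i + -diagVec s = x + -diagVec s := by rw [h']
        have e : x + diagVec s + unitVec i + -diagVec s = x + unitVec i := by abel
        rw [e] at this
        exact add_left_cancel this
      · exact absurd (add_eq_left.1 h') (uvec_ne_zero i)
  -- the coordinate `j ≠ i` of `e_i` is `0`, that of `± j_s` is `± 1`
  obtain ⟨j, hj⟩ : ∃ j : Fin 2, j ≠ i := ⟨i + 1, by fin_cases i <;> decide⟩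
  have h0 : (unitVec i : Site 2) j = 0 := by simp [hj]
  have h1 := abs_diagVec_apply s j
  rcases key with k | k
  · rw [k] at h0; rw [h0] at h1; norm_num at h1
  · rw [k, Pi.neg_apply] at h0; rw [neg_eq_zero.1 h0] at h1; norm_num at h1

/-- The diagonal hopping interaction vanishes on singletons. [cite: XuEtAl2024, eq. (1)] -/
theorem diagHoppingFermionInteraction_apply_singleton (x : Site 2) :
    (diagHoppingFermionInteraction t').Φ {x} = 0 :=
  diagHoppingFermionInteraction_apply_eq_zero t' fun y s => singleton_ne_pair_diagVec x y s

/-- The diagonal hopping interaction vanishes on nearest-neighbour pairs. [cite: XuEtAl2024, eq. (1)] -/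
theorem diagHoppingFermionInteraction_apply_pair_unitVec (x : Site 2) (i : Fin 2) :
    (diagHoppingFermionInteraction t').Φ {x, x + unitVec i} = 0 :=
  diagHoppingFermionInteraction_apply_eq_zero t' fun y s => pair_unitVec_ne_pair_diagVec x i y s

/-- The nearest-neighbour Hubbard interaction vanishes on diagonal pairs. [cite: arXiv9311033, §2] -/
theorem hubbardFermionInteraction_apply_pair_diagVec (t U : ℝ) (x : Site 2) (s : Fin 2) :
    (hubbardFermionInteraction 2 t U).Φ {x, x + diagVec s} = 0 :=
  hubbardFermionInteraction_apply_eq_zero t U (fun y h => singleton_ne_pair_diagVec y x s h.symm)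
    fun y i h => pair_unitVec_ne_pair_diagVec y i x s h.symm

end Terms

/-! ### The mean-energy observable of the diagonal hopping interaction -/

section MeanEnergy

variable (t' : ℝ)

/-- **The mean-energy observable of the diagonal hopping interaction** (range `1`): in
`𝔄_{[-1,1]²}`, `E_Φ = Σ_s (½ Γ(Φ{0, j_s}) + ½ Γ(Φ{-j_s, 0}))`, one half of each of the four
diagonal bonds through the origin (every other `X ∋ 0` carries `Φ X = 0`).
[cite: BratteliKishimotoRobinson1978, §3 (mean energy functional)] -/
theorem diagHoppingFermionInteraction_meanEnergyObs :
    (diagHoppingFermionInteraction t').meanEnergyObs 1 =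
      ∑ s : Fin 2,
        ((2 : ℂ)⁻¹ • fermionEmbed (PolySite.incl (pair_diagVec_subset_thicken_one s))
            ((diagHoppingFermionInteraction t').Φ {0, 0 + diagVec s}) +
          (2 : ℂ)⁻¹ • fermionEmbed (PolySite.incl (pair_neg_diagVec_subset_thicken_one s))
            ((diagHoppingFermionInteraction t').Φ {-diagVec s, -diagVec s + diagVec s})) := by
  classical
  set T : Finset (Site 2) := thicken ({0} : Finset (Site 2)) 1 with hT
  set F : Finset (Site 2) → FermionOp T := fun X =>
    if h : X ⊆ T then ((X.card : ℂ)⁻¹) • fermionEmbed (PolySite.incl h) ((diagHoppingFermionInteraction t').Φ X)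
    else 0 with hF
  rw [FermionInteraction.meanEnergyObs_eq_sum]
  change ∑ X ∈ T.powerset with (0 : Site 2) ∈ X, F X = _
  -- the support: `{0, j_s}`, `{-j_s, 0}`
  set S' : Finset (Finset (Site 2)) :=
    (univ.image fun s : Fin 2 => ({0, 0 + diagVec s} : Finset (Site 2))) ∪
      univ.image fun s : Fin 2 => ({-diagVec s, -diagVec s + diagVec s} : Finset (Site 2)) with hS'
  have hS'sub : S' ⊆ T.powerset.filter fun X => (0 : Site 2) ∈ X := by
    intro X hX
    rw [hS', mem_union, mem_image, mem_image] at hX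
    rw [mem_filter, mem_powerset]
    rcases hX with ⟨s, -, rfl⟩ | ⟨s, -, rfl⟩
    · exact ⟨pair_diagVec_subset_thicken_one s, mem_insert_self _ _⟩
    · refine ⟨pair_neg_diagVec_subset_thicken_one s, ?_⟩
      rw [neg_add_cancel]
      exact mem_insert_of_mem (mem_singleton_self _)
  have hzero : ∀ X ∈ T.powerset.filter (fun X => (0 : Site 2) ∈ X), X ∉ S' → F X = 0 := by
    intro X hX hXS
    rw [mem_filter, mem_powerset] at hX
    have hΦ : (diagHoppingFermionInteraction t').Φ X = 0 := by
      refine diagHoppingFermionInteraction_apply_eq_zero t' (fun x s hx => hXS ?_)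
      have h0 := hX.2
      rw [hx, mem_insert, mem_singleton] at h0
      rw [hS', hx, mem_union, mem_image, mem_image]
      rcases h0 with h0 | h0
      · exact Or.inl ⟨s, mem_univ _, by rw [← h0, zero_add]⟩
      · refine Or.inr ⟨s, mem_univ _, ?_⟩
        have : x = -diagVec s := eq_neg_of_add_eq_zero_left h0.symm
        rw [this]
    simp only [hF, hΦ, map_zero, smul_zero, dite_eq_ite, ite_self]
  rw [← Finset.sum_subset hS'sub hzero]
  -- split the sum over `S'`
  have hdisj : Disjoint (univ.image fun s : Fin 2 => ({0, 0 + diagVec s} : Finset (Site 2)))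
      (univ.image fun s : Fin 2 => ({-diagVec s, -diagVec s + diagVec s} : Finset (Site 2))) := by
    rw [disjoint_iff_ne]
    rintro X hX Y hY rfl
    rw [mem_image] at hX hY
    obtain ⟨s, -, rfl⟩ := hX
    obtain ⟨s', -, hs'⟩ := hY
    have hmem : -diagVec s' ∈ ({0, 0 + diagVec s} : Finset (Site 2)) := hs' ▸ mem_insert_self _ _
    rw [mem_insert, mem_singleton, zero_add, neg_eq_zero] at hmem
    rcases hmem with h | h
    · exact diagVec_ne_zero s' h
    · exact diagVec_add_diagVec_ne_zero s' s (show diagVec s' + diagVec s = 0 by rw [← h, add_neg_cancel])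
  have hinj1 : Set.InjOn (fun s : Fin 2 => ({0, 0 + diagVec s} : Finset (Site 2))) ↑(univ : Finset (Fin 2)) := by
    intro s _ s' _ h
    dsimp only at h
    have hmem : 0 + diagVec s ∈ ({0, 0 + diagVec s'} : Finset (Site 2)) := h ▸ mem_insert_of_mem (mem_singleton_self _)
    rw [mem_insert, mem_singleton, zero_add, zero_add] at hmem
    rcases hmem with h' | h'
    · exact absurd h' (diagVec_ne_zero s)
    · exact diagVec_injective h'
  have hinj2 : Set.InjOn (fun s : Fin 2 => ({-diagVec s, -diagVec s + diagVec s} : Finset (Site 2)))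
      ↑(univ : Finset (Fin 2)) := by
    intro s _ s' _ h
    dsimp only at h
    have hmem : -diagVec s ∈ ({-diagVec s', -diagVec s' + diagVec s'} : Finset (Site 2)) := by
      have : -diagVec s ∈ ({-diagVec s, -diagVec s + diagVec s} : Finset (Site 2)) := mem_insert_self _ _
      rwa [h] at this
    rw [mem_insert, mem_singleton, neg_add_cancel, neg_inj, neg_eq_zero] at hmem
    rcases hmem with h' | h'
    · exact diagVec_injective h'
    · exact absurd h' (diagVec_ne_zero s)
  rw [hS', Finset.sum_union hdisj, Finset.sum_image hinj1, Finset.sum_image hinj2, ← Finset.sum_add_distrib]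
  -- evaluate `F` on the two kinds of sets
  have h1T : ∀ s : Fin 2, ({0, 0 + diagVec s} : Finset (Site 2)) ⊆ T := fun s =>
    pair_diagVec_subset_thicken_one s
  have h2T : ∀ s : Fin 2, ({-diagVec s, -diagVec s + diagVec s} : Finset (Site 2)) ⊆ T := fun s =>
    pair_neg_diagVec_subset_thicken_one s
  have hF1 : ∀ s : Fin 2, F {0, 0 + diagVec s} =
      (2 : ℂ)⁻¹ • fermionEmbed (PolySite.incl (h1T s)) ((diagHoppingFermionInteraction t').Φ {0, 0 + diagVec s}) := by
    intro s
    simp only [hF]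
    rw [dif_pos (h1T s), card_pair (self_ne_add_diagVec (0 : Site 2) s), Nat.cast_ofNat]
  have hF2 : ∀ s : Fin 2, F {-diagVec s, -diagVec s + diagVec s} =
      (2 : ℂ)⁻¹ • fermionEmbed (PolySite.incl (h2T s))
        ((diagHoppingFermionInteraction t').Φ {-diagVec s, -diagVec s + diagVec s}) := by
    intro s
    simp only [hF]
    rw [dif_pos (h2T s), card_pair (self_ne_add_diagVec (-diagVec s : Site 2) s), Nat.cast_ofNat]
  exact Finset.sum_congr rfl fun s _ => by rw [hF1, hF2]

end MeanEnergy

/-! ### Pointwise sums of interactions -/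

namespace FermionInteraction

variable {d : ℕ}

/-- The local Hamiltonians of a pointwise sum of interactions are the sums of the local
Hamiltonians. [cite: ArakiMoriya2003, §5.1 (local Hamiltonian H(I))] -/
theorem localHamiltonian_of_add {Ψ Ψ₁ Ψ₂ : FermionInteraction d} (h : ∀ X, Ψ.Φ X = Ψ₁.Φ X + Ψ₂.Φ X)
    (Λ : Finset (Site d)) : Ψ.localHamiltonian Λ = Ψ₁.localHamiltonian Λ + Ψ₂.localHamiltonian Λ := by
  unfold localHamiltonian
  rw [← Finset.sum_add_distrib]
  exact Finset.sum_congr rfl fun X _ => by rw [h, map_add]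

/-- The mean-energy observable of a pointwise sum of interactions is the sum of the mean-energy
observables. [cite: BratteliKishimotoRobinson1978, §3 (mean energy functional)] -/
theorem meanEnergyObs_of_add {Ψ Ψ₁ Ψ₂ : FermionInteraction d} (h : ∀ X, Ψ.Φ X = Ψ₁.Φ X + Ψ₂.Φ X)
    (R : ℝ) : Ψ.meanEnergyObs R = Ψ₁.meanEnergyObs R + Ψ₂.meanEnergyObs R := by
  unfold meanEnergyObs
  rw [← Finset.sum_add_distrib]
  exact Finset.sum_congr rfl fun X _ => by rw [h, map_add, smul_add]

/-- A pointwise sum of Hermitian interactions is Hermitian. [cite: ArakiMoriya2003, §1 assumption (II)] -/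
theorem isHermitian_of_add {Ψ Ψ₁ Ψ₂ : FermionInteraction d} (h : ∀ X, Ψ.Φ X = Ψ₁.Φ X + Ψ₂.Φ X)
    (h₁ : Ψ₁.IsHermitian) (h₂ : Ψ₂.IsHermitian) : Ψ.IsHermitian := fun X => by
  rw [h X]
  exact (h₁ X).add (h₂ X)

/-- A pointwise sum of even interactions is even. [cite: ArakiMoriya2003, §1 assumption (II)] -/
theorem isEven_of_add {Ψ Ψ₁ Ψ₂ : FermionInteraction d} (h : ∀ X, Ψ.Φ X = Ψ₁.Φ X + Ψ₂.Φ X)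
    (h₁ : Ψ₁.IsEven) (h₂ : Ψ₂.IsEven) : Ψ.IsEven := fun X => by
  rw [h X, map_add, h₁ X, h₂ X]

end FermionInteraction

/-! ### The `t–t'` Hubbard interaction -/

/-- **The `t–t'` Hubbard interaction on `ℤ²`**: nearest-neighbour hopping `t`, next-nearest
(diagonal) hopping `t'`, on-site repulsion `U` — the pointwise sum of `hubbardFermionInteraction 2 t U`
and `diagHoppingFermionInteraction t'`: `Φ {x} = U n_{x↑} n_{x↓}`,
`Φ {x, x + e_i} = -t Σ_σ (c†c + h.c.)`, `Φ {x, x + e₁ ± e₂} = -t' Σ_σ (c†c + h.c.)`, `Φ X = 0`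
otherwise. Xu et al. (2024) eq. (1) with `t' / t = -0.2`. [cite: XuEtAl2024, eq. (1)] -/
def hubbardTTPrimeFermionInteraction (t t' U : ℝ) : FermionInteraction 2 where
  Φ X := (hubbardFermionInteraction 2 t U).Φ X + (diagHoppingFermionInteraction t').Φ X

/-- The terms of the `t–t'` interaction are the sums of the nearest-neighbour and diagonal terms
(definitional unfolding). [cite: XuEtAl2024, eq. (1)] -/
theorem hubbardTTPrimeFermionInteraction_apply (t t' U : ℝ) (X : Finset (Site 2)) :
    (hubbardTTPrimeFermionInteraction t t' U).Φ X =
      (hubbardFermionInteraction 2 t U).Φ X + (diagHoppingFermionInteraction t').Φ X := rfl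

/-- **The `t–t'` Hubbard interaction is even.** [cite: ArakiMoriya2003, §1 assumption (II)] -/
theorem hubbardTTPrimeFermionInteraction_isEven (t t' U : ℝ) :
    (hubbardTTPrimeFermionInteraction t t' U).IsEven :=
  FermionInteraction.isEven_of_add (hubbardTTPrimeFermionInteraction_apply t t' U)
    (hubbardFermionInteraction_isEven t U) (diagHoppingFermionInteraction_isEven t')

/-- **The `t–t'` Hubbard interaction is Hermitian** (real `t, t', U`). [cite: XuEtAl2024, eq. (1)] -/
theorem hubbardTTPrimeFermionInteraction_isHermitian (t t' U : ℝ) :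
    (hubbardTTPrimeFermionInteraction t t' U).IsHermitian :=
  FermionInteraction.isHermitian_of_add (hubbardTTPrimeFermionInteraction_apply t t' U)
    (hubbardFermionInteraction_isHermitian t U) (diagHoppingFermionInteraction_isHermitian t')

/-- The local Hamiltonians of the `t–t'` interaction: `H^{tt'}_Λ = H^{t,U}_Λ + H^{t'}_Λ`.
[cite: ArakiMoriya2003, §5.1 (local Hamiltonian H(I))] -/
theorem hubbardTTPrimeFermionInteraction_localHamiltonian (t t' U : ℝ) (Λ : Finset (Site 2)) :
    (hubbardTTPrimeFermionInteraction t t' U).localHamiltonian Λ =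
      (hubbardFermionInteraction 2 t U).localHamiltonian Λ +
        (diagHoppingFermionInteraction t').localHamiltonian Λ :=
  FermionInteraction.localHamiltonian_of_add (hubbardTTPrimeFermionInteraction_apply t t' U) Λ

/-- The mean-energy observable of the `t–t'` interaction: `E^{tt'}_Φ = E^{t,U}_Φ + E^{t'}_Φ`.
[cite: BratteliKishimotoRobinson1978, §3 (mean energy functional)] -/
theorem hubbardTTPrimeFermionInteraction_meanEnergyObs (t t' U : ℝ) (R : ℝ) :
    (hubbardTTPrimeFermionInteraction t t' U).meanEnergyObs R =
      (hubbardFermionInteraction 2 t U).meanEnergyObs R + (diagHoppingFermionInteraction t').meanEnergyObs R :=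
  FermionInteraction.meanEnergyObs_of_add (hubbardTTPrimeFermionInteraction_apply t t' U) R

/-- On-site term of the `t–t'` interaction: `Φ {x} = U n_{x↑} n_{x↓}`. [cite: XuEtAl2024, eq. (1)] -/
theorem hubbardTTPrimeFermionInteraction_apply_singleton (t t' U : ℝ) (x : Site 2) :
    (hubbardTTPrimeFermionInteraction t t' U).Φ {x} =
      (U : ℂ) • (nAt x (mem_singleton_self x) 0 * nAt x (mem_singleton_self x) 1) := by
  rw [hubbardTTPrimeFermionInteraction_apply, hubbardFermionInteraction_apply_singleton,
    diagHoppingFermionInteraction_apply_singleton, add_zero]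

/-- Nearest-neighbour bond term of the `t–t'` interaction. [cite: XuEtAl2024, eq. (1)] -/
theorem hubbardTTPrimeFermionInteraction_apply_pair_unitVec (t t' U : ℝ) (x : Site 2) (i : Fin 2) :
    (hubbardTTPrimeFermionInteraction t t' U).Φ {x, x + unitVec i} =
      (hubbardFermionInteraction 2 t U).Φ {x, x + unitVec i} := by
  rw [hubbardTTPrimeFermionInteraction_apply, diagHoppingFermionInteraction_apply_pair_unitVec, add_zero]

/-- Diagonal bond term of the `t–t'` interaction. [cite: XuEtAl2024, eq. (1)] -/
theorem hubbardTTPrimeFermionInteraction_apply_pair_diagVec (t t' U : ℝ) (x : Site 2) (s : Fin 2) :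
    (hubbardTTPrimeFermionInteraction t t' U).Φ {x, x + diagVec s} =
      (diagHoppingFermionInteraction t').Φ {x, x + diagVec s} := by
  rw [hubbardTTPrimeFermionInteraction_apply, hubbardFermionInteraction_apply_pair_diagVec, zero_add]

/-- All other terms of the `t–t'` interaction vanish. [cite: XuEtAl2024, eq. (1)] -/
theorem hubbardTTPrimeFermionInteraction_apply_eq_zero (t t' U : ℝ) {X : Finset (Site 2)}
    (h1 : ∀ x : Site 2, X ≠ {x}) (h2 : ∀ (x : Site 2) (i : Fin 2), X ≠ {x, x + unitVec i})
    (h3 : ∀ (x : Site 2) (s : Fin 2), X ≠ {x, x + diagVec s}) :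
    (hubbardTTPrimeFermionInteraction t t' U).Φ X = 0 := by
  rw [hubbardTTPrimeFermionInteraction_apply, hubbardFermionInteraction_apply_eq_zero t U h1 h2,
    diagHoppingFermionInteraction_apply_eq_zero t' h3, add_zero]

end Literature.MathematicalPhysics.QuantumLattice

end
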